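import Summits.BirchSwinnertonDyer.BirchSwinnertonDyer.Theorems.GenusKolyvaginAtTwoCasselsTatePTcRealReadout
import Summits.BirchSwinnertonDyer.BirchSwinnertonDyer.Theorems.GenusKolyvaginAtTwoVisiblePairAtTwoCasselsTateShaThree
import Literature.NumberTheory.EllipticCurves.CasselsTateAlternating
import Literature.NumberTheory.EllipticCurves.WeilPairingProofs
import HarnessLib

/-!
# Route `GenusKolyvaginAtTwo`, crux `KolyvaginExactAtTwo` (22137) → Q3-inner: the `ℚ`-pair capstone of LINE 6 with its whole
# Cassels–Tate block DISCHARGED — no Weil data, no `hH3`, no `hB₁`/`hB₂`, no alternation input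

Seat `bsd-line-gk2-p2` g13 (cell `bsd-f1-sign2`), `--supports 22137`, helper. THEOREMS ONLY (no definition, no named fact, no `sorry`).

The capstone chain of this lineage displayed, for the two Cassels–Tate pairings at the even level `2^L` over `ℚ` (member `E` and twin
`E^{(d_K)}`): Weil-pairing data `e₁`, `e₂`; `hH3` (`Ш³(ℚ, μ) = 0`); the level-pairing property `hB₁`, `hB₂` (= Poitou–Tate 4.10 (a) in
cochain form `hPTc` + Lemma 6.15 `h615` + Cassels' alternation `hct_alt`). All of it is now in the tree:
`hH3` — `VisiblePairAtTwo.shaThree_mu_eq_zero` (p669505); `h615` — `CasselsTateAnyLevel.lemma615Input_canonical` (p668571);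
`hPTc` over `ℚ` at every level — `CasselsTatePTcReal.hPTc_canonical` (p673162); `hct_alt` at every level — LEAD gk2-p1's
`Literature.NumberTheory.EllipticCurves.ctGeneralFun_self_eq_zero` (p671339, Cassels 1962 via the theta group); the Weil pairings —
`exists_weilPairing_holds`. Hence:

* **`selmer_eq_and_card_selmer_twin_eq_ctFree`** — `Sel_{2^M}(E/ℚ) = ℤ/2^M · x` and `#Sel_{2^M}(E^{(d_K)}/ℚ) = 2^{2M₀}` at `M = L + L`,
  `2M₀ ≤ L`, from gk2-p3's records `I : Input W K (L+L)`, `I₁ : Input W K 1`, `hx : x ∈ δ(E(ℚ))`, the shallow certificate at `ℓ₀`,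
  `h44ord` (Prop. 4.4 in ORDER form at `λ₀`) and `hι` (Lemma 4.6 across levels) — and NOTHING about the Cassels–Tate pairing.

What the `ℚ`-pair frame of Q3-inner still displays is therefore exactly gk2-p3's side: the inhabitant of `Input` (Kolyvagin classes over
`ℚ` with McCallum's Prop. 4.4 / Lemma 4.3 at the places of `d_K` — see gk2-p3 g14's DEFECT-LEDGER) and the three level-`2` inputs.
BSD is not proved by any of this.

References: [McCallumLMS1991] §4 Prop. 4.4, 4.7, Lemma 4.6, §5 Lemma 5.3, Thm. 5.4; [MilneADT2006] I Thm. 4.10, §6 Prop. 6.9,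
Thm. 6.13 (a)(b), Lemma 6.15; [Cassels1962ArithmeticIV]; [SilvermanAEC2009] III §8.
-/

set_option linter.dupNamespace false -- tree convention: `Summit.BirchSwinnertonDyer.BirchSwinnertonDyer.Theorems` (summit = sub-problem)
set_option autoImplicit false

noncomputable section

open scoped Classical

namespace Summit.BirchSwinnertonDyer.BirchSwinnertonDyer.Theorems.GenusExact.VisiblePairAtTwo

open WeierstrassCurve NumberField IsDedekindDomain Field Function Rat.HeightOneSpectrum
open Literature.NumberTheory.EllipticCurves Literature.NumberTheory.GaloisRepresentations
open Literature.NumberTheory.GaloisCohomology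
open Literature.NumberTheory.GaloisRepresentations.DiscreteGaloisModule (mu MuCarrier)
open Literature.NumberTheory.EllipticCurves.KolyvaginDescent
open Literature.GroupTheory.FiniteAbelian

section Capstone

variable {W : WeierstrassCurve ℚ} [W.IsElliptic] [W.IsGloballyMinimal] {K : Type} [Field K] [NumberField K]
  {L : ℕ} {θ : K} {hθ : θ ∉ Set.range (algebraMap ℚ K)}
  {hθsq : θ ^ 2 = algebraMap ℚ K ((NumberField.discr K : ℤ) : ℚ)} [(twin W K).IsElliptic]

/-- **The level-`2^k` Cassels–Tate pairing of THE canonical invariant maps on `Ш(E/ℚ)[2^k]` — indeed on `Ш(E/K)[p^k]` for every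
number field, every curve, every prime power — IS A LEVEL PAIRING, unconditionally** (this seat's
`CasselsTatePTcReal.isLevelPairing_ctLevelPairing_canonical_of_alt` ∘ LEAD gk2-p1's `ctGeneralFun_self_eq_zero`).
[cite: MilneADT2006, Ch. I §6 Prop. 6.9, Thm. 6.13 (a)(b)][cite: Cassels1962ArithmeticIV] -/
theorem isLevelPairing_ctLevelPairing_canonical {F : Type} [Field F] [NumberField F] (V : WeierstrassCurve F) [V.IsElliptic]
    (p k : ℕ) [Fact p.Prime] [NeZero (p ^ k)] [NeZero (p ^ k * p ^ k)] (hk : 0 < k)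
    (e : geomTorsion V ((p ^ k * p ^ k : ℕ) : ℤ) → geomTorsion V ((p ^ k * p ^ k : ℕ) : ℤ) → AlgebraicClosure F)
    (hμ : ∀ S T, e S T ^ (p ^ k * p ^ k) = 1)
    (hadd₁ : ∀ S₁ S₂ T, e (S₁ + S₂) T = e S₁ T * e S₂ T)
    (hadd₂ : ∀ S T₁ T₂, e S (T₁ + T₂) = e S T₁ * e S T₂)
    (hgal : ∀ (σ : absoluteGaloisGroup F) (S T : geomTorsion V ((p ^ k * p ^ k : ℕ) : ℤ)), σ • e S T = e (σ • S) (σ • T))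
    (halt : ∀ T, e T T = 1) (hnd : ∀ T, (∀ S, e S T = 1) → T = 0) :
    IsLevelPairing (p ^ k)
      (ctLevelPairing V (p ^ k) e hμ hadd₁ hadd₂ hgal (LocalInvariants.canonical F (p ^ k * p ^ k)) halt
        (sumInvLocalizationEqZero_canonical_of_numberField F (p ^ k * p ^ k)) (shaThree_mu_eq_zero F (p ^ k * p ^ k))
        (localTerm_finite_support V (p ^ k) e hμ hadd₁ hadd₂ hgal halt (LocalInvariants.canonical F (p ^ k * p ^ k)))) :=
  CasselsTatePTcReal.isLevelPairing_ctLevelPairing_canonical_of_alt V p k e hμ hadd₁ hadd₂ hgal halt hnd hk fun _ ha hma =>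
    ctGeneralFun_self_eq_zero halt (LocalInvariants.canonical F (p ^ k * p ^ k))
      (sumInvLocalizationEqZero_canonical_of_numberField F (p ^ k * p ^ k)) (shaThree_mu_eq_zero F (p ^ k * p ^ k)) ha hma

/-- **Exactness of the `ℚ`-pair instance — the Cassels–Tate block ENTIRELY DISCHARGED**: `Sel_{2^M}(E/ℚ) = ℤ/2^M · x` and
`#Sel_{2^M}(E^{(d_K)}/ℚ) = 2^{2M₀}` at the even level `M = L + L`, `2M₀ ≤ L`, from gk2-p3's records `I`, `I₁`, `hx`, the shallow
certificate and the level-`2` inputs `h44ord`, `hι` ONLY. The Weil pairings on `E[2^{2L}]`, `E^{(d_K)}[2^{2L}]` are chosen inside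
(`exists_weilPairing_holds`); both Cassels–Tate pairings of THE invariant maps at level `2^L` are level pairings by
`isLevelPairing_ctLevelPairing_canonical`. [cite: McCallumLMS1991, §4 Prop. 4.7, §5 Lemma 5.3 and Thm. 5.4]
[cite: MilneADT2006, Ch. I Thm. 4.10, §6 Prop. 6.9, Thm. 6.13 (a)(b)][cite: Cassels1962ArithmeticIV] -/
theorem selmer_eq_and_card_selmer_twin_eq_ctFree (I : Input W K (L + L) hθ hθsq) (I₁ : Input W K 1 hθ hθsq)
    (hcm : ¬ W.HasCM) (hΔ : W.Δ < 0) (hK : IsImaginaryQuadratic K) (hodd : Odd (NumberField.discr K))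
    (hns : ¬ IsSquare ((NumberField.discr K : ℚ) * -|W.Δ|))
    (hρ : ∀ n : ℕ, W.HasSurjectiveModNGaloisRep (2 ^ n : ℕ)) (hL : 2 * I.M₀ ≤ L) (hL1 : 1 ≤ L)
    (hx : torsionH1ToH1 W (lvl (L + L)) I.x = 0)
    -- the shallow certificate, in class form, and the remaining level-`2` inputs
    {ℓ₀ : ℕ} (hkol₀ : kolPrime W K 1 ℓ₀) (hy0 : I₁.c₂ ℓ₀ ≠ 0) (h0 : I₁.c₁ 1 = 0)
    (h44ord : ∀ ℓ, kolPrime W K (L + L) ℓ → ℓ ≠ ℓ₀ →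
      (I₁.c₁ (ℓ * ℓ₀) ∈ a₁ W 1 ℓ₀ ↔ I₁.c₂ ℓ ∈ a₂ W K 1 ℓ₀))
    (hι : ∀ ℓ, kolPrime W K (L + L) ℓ → torsionH1OfDvd (twin W K) (lvl_one_dvd_lvl (hL1.trans (Nat.le_add_right L L)))
      (I₁.c₂ ℓ) = ((2 : ℤ) ^ (L + L - 1)) • I.c₂ ℓ) :
    selmerGroup W (lvl (L + L)) = AddSubgroup.zmultiples I.x ∧
      Nat.card (selmerGroup (twin W K) (lvl (L + L))) = 2 ^ (2 * I.M₀) := by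
  haveI : Fact (Nat.Prime 2) := ⟨Nat.prime_two⟩
  haveI : NeZero (2 ^ L) := ⟨pow_ne_zero _ two_ne_zero⟩
  haveI : NeZero (2 ^ L * 2 ^ L) := ⟨mul_ne_zero (NeZero.ne _) (NeZero.ne _)⟩
  have hk : 0 < L := by omega
  -- the Weil pairings on `E[2^L · 2^L]` and `E^{(d_K)}[2^L · 2^L]`
  have hpk : 2 ≤ 2 ^ L := le_trans (le_refl 2) (Nat.le_self_pow hk.ne' 2)
  have h2 : 2 ≤ 2 ^ L * 2 ^ L := le_trans hpk (Nat.le_mul_of_pos_right _ (NeZero.pos _))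
  have hne : ((2 ^ L * 2 ^ L : ℕ) : ℚ) ≠ 0 := Nat.cast_ne_zero.2 (NeZero.ne _)
  obtain ⟨e₁, hμ₁, hadd₁₁, hadd₂₁, halt₁, hnondeg₁, hgal₁⟩ := exists_weilPairing_holds W (2 ^ L * 2 ^ L) h2 hne
  obtain ⟨e₂, hμ₂, hadd₁₂, hadd₂₂, halt₂, hnondeg₂, hgal₂⟩ := exists_weilPairing_holds (twin W K) (2 ^ L * 2 ^ L) h2 hne
  exact selmer_eq_and_card_selmer_twin_eq_of_canonical_levelPairings I I₁ hcm hΔ hK hodd hns hρ hL hL1 e₁ hμ₁ hadd₁₁ hadd₂₁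
    hgal₁ halt₁ hnondeg₁ e₂ hμ₂ hadd₁₂ hadd₂₂ hgal₂ halt₂ hnondeg₂
    (isLevelPairing_ctLevelPairing_canonical W 2 L hk e₁ hμ₁ hadd₁₁ hadd₂₁ hgal₁ halt₁ hnondeg₁)
    (isLevelPairing_ctLevelPairing_canonical (twin W K) 2 L hk e₂ hμ₂ hadd₁₂ hadd₂₂ hgal₂ halt₂ hnondeg₂)
    hx hkol₀ hy0 h0 h44ord hι

end Capstone

end Summit.BirchSwinnertonDyer.BirchSwinnertonDyer.Theorems.GenusExact.VisiblePairAtTwo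

end
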